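import Summits.NavierStokesRegularity.NavierStokesRegularity.Theorems.RellichScarScarRigidityPaintedLadderRepresentation
import Summits.NavierStokesRegularity.NavierStokesRegularity.Theorems.RellichScarScarRigidityPaintedLadderKernelTaylor
import HarnessLib

/-!
# `ScarRigidity`, line `moment-conditioned-rellich` — stub `stub_paintedLadderHigher` (PL≥2), part 6:
# homogeneous smooth functions, and the Taylor polynomials of the Newtonian kernel are solid harmonics

Crux stmt-NavierStokesRegularity-11717 (route RellichScar), helper file (`--supports`) for the registered stub
`stub_paintedLadderHigher`.  The coefficients of the multipole expansion of part 5 are the moments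
`∫ DᵐΓ(x)(y,…,y) h(y) dy`; to identify them with the RADIATIVE moments of the line (`RadiativeMomentsVanish`) one
needs that the Taylor polynomials of the kernel and their derivatives are solid harmonics (`IsSolidHarmonic`):

* positively homogeneous smooth functions `f(r y) = rᵈ f(y)` (`r > 0`) on `ℝ³`: `‖f(y)‖ ≤ C‖y‖ᵈ`
  (`exists_norm_le_of_homogeneous`); `Dⁱf(r y) = r^{d−i} Dⁱf(y)` for `i ≤ d` and `Dⁱf = 0` for `i > d`
  (`iteratedFDeriv_homogeneous`, `iteratedFDeriv_eq_zero_of_homogeneous`); derivatives of solid harmonics in fixed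
  directions are solid harmonics of the lower degree (`isSolidHarmonic_iteratedFDeriv_apply`);
* **the Taylor polynomials `P_m^x(y) = DᵐΓ(x)(y,…,y)` of the Newtonian kernel at `x ≠ 0` are solid harmonics of degree
  `m`** (`isSolidHarmonic_newtonTaylorPoly`): `P_m^x(y) = (d/ds)ᵐ Γ(x + s y)|_{s=0}` and `Δ_y Γ(x + s y) = s² ΔΓ(x + s y) = 0`
  for small `s`, with the tree's exchange of `∂ₛ` and `D²_y` for the jointly smooth `(s, y) ↦ Γ∞(x + s y)`.
-/

noncomputable section

open Set Filter Function MeasureTheory Metric TopologicalSpace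
open scoped Topology ContDiff Laplacian InnerProductSpace RealInnerProductSpace
open Literature.Analysis.FluidPDE InnerProductSpace

set_option linter.dupNamespace false -- D-0017: `Summit.<S>.<S>.…` repeats the summit name by design

-- nested operator types
set_option maxSynthPendingDepth 4

namespace Summit.NavierStokesRegularity.NavierStokesRegularity.Theorems.RellichScarScarRigidity

/-! ### Positively homogeneous smooth functions -/

section Homogeneous

variable {F : Type*} [NormedAddCommGroup F] [NormedSpace ℝ F]

/-- A continuous function on `ℝ³`, positively homogeneous of degree `d` (`f(r y) = rᵈ f(y)`, `r > 0`), is bounded by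
`C‖y‖ᵈ` (`C` = its bound on the unit sphere, and `|f(0)|`). [folklore] -/
theorem exists_norm_le_of_homogeneous {f : EuclideanSpace ℝ (Fin 3) → F} (hfc : Continuous f) (d : ℕ)
    (hf : ∀ r : ℝ, 0 < r → ∀ y, f (r • y) = r ^ d • f y) :
    ∃ C : ℝ, 0 ≤ C ∧ ∀ y, ‖f y‖ ≤ C * ‖y‖ ^ d := by
  obtain ⟨M, hM⟩ := (isCompact_sphere (0 : EuclideanSpace ℝ (Fin 3)) 1).exists_bound_of_continuousOn hfc.continuousOn
  have hM0 : 0 ≤ M := (norm_nonneg _).trans (hM (EuclideanSpace.single 0 1) (by simp))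
  refine ⟨max M ‖f 0‖, le_max_of_le_left hM0, fun y => ?_⟩
  by_cases hy : y = 0
  · subst hy
    rcases Nat.eq_zero_or_pos d with hd | hd
    · subst hd; simp
    · have h2 := hf 2 two_pos 0
      rw [smul_zero] at h2
      have h0 : f 0 = 0 := by
        have h3 : ((2 : ℝ) ^ d - 1) • f 0 = 0 := by rw [sub_smul, one_smul, ← h2, sub_self]
        have h4 : (2 : ℝ) ^ d - 1 ≠ 0 := by
          have : (1 : ℝ) < 2 ^ d := one_lt_pow₀ one_lt_two hd.ne'
          linarith
        exact (smul_eq_zero.1 h3).resolve_left h4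
      rw [h0, norm_zero]
      positivity
  · have hy0 : 0 < ‖y‖ := norm_pos_iff.2 hy
    have hu : ‖y‖⁻¹ • y ∈ sphere (0 : EuclideanSpace ℝ (Fin 3)) 1 := by
      rw [mem_sphere_zero_iff_norm, norm_smul, norm_inv, norm_norm, inv_mul_cancel₀ hy0.ne']
    have h1 : f y = ‖y‖ ^ d • f (‖y‖⁻¹ • y) := by
      rw [← hf ‖y‖ hy0, smul_smul, mul_inv_cancel₀ hy0.ne', one_smul]
    rw [h1, norm_smul, norm_pow, norm_norm, mul_comm]
    exact mul_le_mul_of_nonneg_right ((hM _ hu).trans (le_max_left _ _)) (by positivity)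

/-- **Derivatives of homogeneous functions**: for `f` smooth and positively homogeneous of degree `d = i + j`,
`Dⁱf(r y) = rʲ Dⁱf(y)` for `r > 0` (`f ∘ (r·) = rᵈ f` and the chain rule for the homothety). [folklore] -/
theorem iteratedFDeriv_homogeneous {f : EuclideanSpace ℝ (Fin 3) → F} (hfs : ContDiff ℝ ∞ f) {d : ℕ}
    (hf : ∀ r : ℝ, 0 < r → ∀ y, f (r • y) = r ^ d • f y) {i j : ℕ} (hij : d = i + j) {r : ℝ} (hr : 0 < r)
    (y : EuclideanSpace ℝ (Fin 3)) : iteratedFDeriv ℝ i f (r • y) = r ^ j • iteratedFDeriv ℝ i f y := by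
  set L : EuclideanSpace ℝ (Fin 3) →L[ℝ] EuclideanSpace ℝ (Fin 3) := r • ContinuousLinearMap.id ℝ _ with hL
  have e1 : f ∘ L = r ^ d • f := by funext z; simp [hL, hf r hr z]
  have h1 := L.iteratedFDeriv_comp_right hfs y (i := i) (by exact_mod_cast le_top)
  rw [e1, iteratedFDeriv_const_smul_apply (hfs.contDiffAt.of_le (by exact_mod_cast le_top))] at h1
  -- `h1 : r^d • Dⁱf(y) = Dⁱf(r y) ∘ (L, …, L)`; evaluate
  ext v
  have h2 := congr_arg (fun T : (EuclideanSpace ℝ (Fin 3)) [×i]→L[ℝ] F => T v) h1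
  simp only [smul_apply, ContinuousMultilinearMap.compContinuousLinearMap_apply] at h2
  have h3 : (fun k : Fin i => L (v k)) = fun k => r • v k := by funext k; simp [hL]
  rw [h3, ContinuousMultilinearMap.map_smul_univ, Fin.prod_const] at h2
  have hLy : L y = r • y := by simp [hL]
  rw [hLy] at h2
  -- `h2 : r^d • Dⁱf(y) v = r^i • Dⁱf(r y) v`
  rw [smul_apply]
  have hri : (r ^ i : ℝ) ≠ 0 := pow_ne_zero _ hr.ne'
  have h4 : iteratedFDeriv ℝ i f (r • y) v = (r ^ i)⁻¹ • (r ^ d • iteratedFDeriv ℝ i f y v) := by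
    rw [h2, smul_smul, inv_mul_cancel₀ hri, one_smul]
  rw [h4, smul_smul, hij, pow_add, ← mul_assoc, inv_mul_cancel₀ hri, one_mul]

/-- **Derivatives above the degree vanish**: a smooth function positively homogeneous of degree `d` has `Dⁱf = 0`
for `i > d` (`Dⁱf(y)(v) = r^{i−d} Dⁱf(r y)(v) → 0` as `r ↓ 0`). [folklore] -/
theorem iteratedFDeriv_eq_zero_of_homogeneous {f : EuclideanSpace ℝ (Fin 3) → F} (hfs : ContDiff ℝ ∞ f) {d : ℕ}
    (hf : ∀ r : ℝ, 0 < r → ∀ y, f (r • y) = r ^ d • f y) {i : ℕ} (hi : d < i) (y : EuclideanSpace ℝ (Fin 3)) :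
    iteratedFDeriv ℝ i f y = 0 := by
  obtain ⟨j, hj⟩ := Nat.exists_eq_add_of_lt hi
  -- `r^{j+1} Dⁱf(r y) = Dⁱf(y)` for `r > 0` (degree bookkeeping `i = d + j + 1`)
  have key : ∀ r : ℝ, 0 < r → r ^ (j + 1) • iteratedFDeriv ℝ i f (r • y) = iteratedFDeriv ℝ i f y := by
    intro r hr
    set L : EuclideanSpace ℝ (Fin 3) →L[ℝ] EuclideanSpace ℝ (Fin 3) := r • ContinuousLinearMap.id ℝ _ with hL
    have e1 : f ∘ L = r ^ d • f := by funext z; simp [hL, hf r hr z]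
    have h1 := L.iteratedFDeriv_comp_right hfs y (i := i) (by exact_mod_cast le_top)
    rw [e1, iteratedFDeriv_const_smul_apply (hfs.contDiffAt.of_le (by exact_mod_cast le_top))] at h1
    ext v
    have h2 := congr_arg (fun T : (EuclideanSpace ℝ (Fin 3)) [×i]→L[ℝ] F => T v) h1
    simp only [smul_apply, ContinuousMultilinearMap.compContinuousLinearMap_apply] at h2
    have h3 : (fun k : Fin i => L (v k)) = fun k => r • v k := by funext k; simp [hL]
    rw [h3, ContinuousMultilinearMap.map_smul_univ, Fin.prod_const] at h2
    have hLy : L y = r • y := by simp [hL]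
    rw [hLy] at h2
    have hrd : (r ^ d : ℝ) ≠ 0 := pow_ne_zero _ hr.ne'
    rw [smul_apply]
    have hpow : r ^ (j + 1) = (r ^ d)⁻¹ * r ^ i := by
      rw [hj, show d + j + 1 = d + (j + 1) by ring, pow_add r d (j + 1), ← mul_assoc, inv_mul_cancel₀ hrd, one_mul]
    calc r ^ (j + 1) • iteratedFDeriv ℝ i f (r • y) v = (r ^ d)⁻¹ • (r ^ i • iteratedFDeriv ℝ i f (r • y) v) := by
          rw [hpow, mul_smul]
      _ = iteratedFDeriv ℝ i f y v := by rw [← h2, smul_smul, inv_mul_cancel₀ hrd, one_smul]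
  -- the left side tends to `0 • Dⁱf(0) = 0` as `r ↓ 0`
  have hcont : Continuous fun r : ℝ => r ^ (j + 1) • iteratedFDeriv ℝ i f (r • y) :=
    (continuous_pow _).smul ((hfs.continuous_iteratedFDeriv (by exact_mod_cast le_top)).comp (continuous_id.smul continuous_const))
  have hlim := (hcont.tendsto 0).mono_left (nhdsWithin_le_nhds (s := Ioi (0 : ℝ)))
  simp only [zero_pow (Nat.succ_ne_zero j), zero_smul] at hlim
  have hconst : Tendsto (fun r : ℝ => r ^ (j + 1) • iteratedFDeriv ℝ i f (r • y)) (𝓝[>] (0 : ℝ))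
      (𝓝 (iteratedFDeriv ℝ i f y)) := by
    refine (tendsto_const_nhds (x := iteratedFDeriv ℝ i f y)).congr' ?_
    filter_upwards [self_mem_nhdsWithin] with r hr
    exact (key r hr).symm
  exact tendsto_nhds_unique hconst hlim

/-- **Derivatives of solid harmonics in fixed directions are solid harmonics**: if `H` is a solid harmonic of degree
`d = b + j` and `J` are `b` fixed directions, then `y ↦ DᵇH(y)(J)` is a solid harmonic of degree `j` (`Δ` commutes with
`Dᵇ`, `laplacian_iteratedFDeriv`). [folklore] -/
theorem isSolidHarmonic_iteratedFDeriv_apply {H : EuclideanSpace ℝ (Fin 3) → ℝ} {d : ℕ} (hH : IsSolidHarmonic d H)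
    {b j : ℕ} (hbj : d = b + j) (J : Fin b → EuclideanSpace ℝ (Fin 3)) :
    IsSolidHarmonic j fun y => iteratedFDeriv ℝ b H y J := by
  obtain ⟨hs, hhom, hΔ⟩ := hH
  set L : ((EuclideanSpace ℝ (Fin 3)) [×b]→L[ℝ] ℝ) →L[ℝ] ℝ :=
    ContinuousMultilinearMap.apply ℝ (fun _ : Fin b => EuclideanSpace ℝ (Fin 3)) ℝ J with hL
  have hD : ContDiff ℝ ∞ (iteratedFDeriv ℝ b H) := hs.iteratedFDeriv_right (m := ∞) le_rfl
  have e : (fun y => iteratedFDeriv ℝ b H y J) = L ∘ iteratedFDeriv ℝ b H := by funext y; simp [hL]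
  refine ⟨?_, fun r y hr => ?_, fun y => ?_⟩
  · rw [e]; exact L.contDiff.comp hD
  · show iteratedFDeriv ℝ b H (r • y) J = r ^ j * iteratedFDeriv ℝ b H y J
    rw [iteratedFDeriv_homogeneous hs (fun r hr y => by rw [hhom r y hr, smul_eq_mul]) hbj hr y,
      smul_apply, smul_eq_mul]
  · have hΔ0 : Δ H = 0 := funext hΔ
    rw [e, ContDiffAt.laplacian_CLM_comp_left (hD.of_le (by norm_cast)).contDiffAt, comp_apply,
      laplacian_iteratedFDeriv hs b y, hΔ0]
    simp

/-- A solid harmonic of degree `d < b` has `Dᵇ = 0`; in particular `y ↦ DᵇH(y)(J)` vanishes identically. [folklore] -/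
theorem iteratedFDeriv_apply_eq_zero_of_isSolidHarmonic {H : EuclideanSpace ℝ (Fin 3) → ℝ} {d : ℕ}
    (hH : IsSolidHarmonic d H) {b : ℕ} (hdb : d < b) (J : Fin b → EuclideanSpace ℝ (Fin 3))
    (y : EuclideanSpace ℝ (Fin 3)) : iteratedFDeriv ℝ b H y J = 0 := by
  rw [iteratedFDeriv_eq_zero_of_homogeneous hH.1 (fun r hr y => by rw [hH.2.1 r y hr, smul_eq_mul]) hdb y]
  rfl

end Homogeneous

/-! ### The Taylor polynomials of the Newtonian kernel are solid harmonics -/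

/-- **The chain rule along a line, forward form**: `(d/ds)ᵐ φ(x + s y) = Dᵐφ(x + s y)(y, …, y)`. [folklore] -/
theorem iteratedDeriv_comp_line {φ : EuclideanSpace ℝ (Fin 3) → ℝ} (hφ : ContDiff ℝ ∞ φ)
    (x y : EuclideanSpace ℝ (Fin 3)) (m : ℕ) (s : ℝ) :
    iteratedDeriv m (fun σ : ℝ => φ (x + σ • y)) s = iteratedFDeriv ℝ m φ (x + s • y) (fun _ => y) := by
  have h := iteratedDeriv_comp_segment hφ x (-y) m s
  have e1 : (fun σ : ℝ => φ (x - σ • -y)) = fun σ => φ (x + σ • y) := by funext σ; simp [smul_neg]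
  rw [e1] at h
  rw [h, smul_neg, sub_neg_eq_add]
  have e2 : (fun _ : Fin m => -y) = fun i : Fin m => (-1 : ℝ) • (fun _ : Fin m => y) i := by funext i; simp
  rw [e2, ContinuousMultilinearMap.map_smul_univ, Fin.prod_const, smul_eq_mul, ← mul_assoc, ← mul_pow]
  norm_num

/-- **The Laplacian of a composition with a homothety**: `Δ(φ(x + s·))(y) = s² Δφ(x + s y)`. [folklore] -/
theorem laplacian_comp_homothety {φ : EuclideanSpace ℝ (Fin 3) → ℝ} (hφ : ContDiff ℝ ∞ φ)
    (x : EuclideanSpace ℝ (Fin 3)) (s : ℝ) (y : EuclideanSpace ℝ (Fin 3)) :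
    Δ (fun z => φ (x + s • z)) y = s ^ 2 * Δ φ (x + s • y) := by
  set b := stdOrthonormalBasis ℝ (EuclideanSpace ℝ (Fin 3)) with hb
  rw [laplacian_eq_iteratedFDeriv_orthonormalBasis _ b, laplacian_eq_iteratedFDeriv_orthonormalBasis _ b]
  change ∑ i, iteratedFDeriv ℝ 2 (fun z => φ (x + s • z)) y ![b i, b i] =
    s ^ 2 * ∑ i, iteratedFDeriv ℝ 2 φ (x + s • y) ![b i, b i]
  set L : EuclideanSpace ℝ (Fin 3) →L[ℝ] EuclideanSpace ℝ (Fin 3) := s • ContinuousLinearMap.id ℝ _ with hL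
  set g : EuclideanSpace ℝ (Fin 3) → ℝ := fun z => φ (x + z) with hg_def
  have hg : ContDiff ℝ ∞ g := hφ.comp (contDiff_const.add contDiff_id)
  have e : (fun z => φ (x + s • z)) = g ∘ L := by funext z; simp [hg_def, hL]
  rw [e, Finset.mul_sum]
  refine Finset.sum_congr rfl fun i _ => ?_
  have hg2 : ContDiff ℝ 2 g := hg.of_le (by norm_cast)
  rw [L.iteratedFDeriv_comp_right hg2 y (i := 2) le_rfl, ContinuousMultilinearMap.compContinuousLinearMap_apply]
  have h3 : (fun k : Fin 2 => L (![b i, b i] k)) = fun k => s • (![b i, b i] k) := by funext k; simp [hL]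
  rw [h3, ContinuousMultilinearMap.map_smul_univ, Fin.prod_const, smul_eq_mul, hg_def, iteratedFDeriv_comp_add_left]
  simp [hL]

/-- `iteratedDeriv` of a finite sum of smooth functions. [folklore] -/
theorem iteratedDeriv_finset_sum {ι : Type*} (u : Finset ι) {f : ι → ℝ → ℝ} {n : ℕ} {x : ℝ}
    (h : ∀ i ∈ u, ContDiffAt ℝ n (f i) x) :
    iteratedDeriv n (fun s => ∑ i ∈ u, f i s) x = ∑ i ∈ u, iteratedDeriv n (f i) x := by
  rw [iteratedDeriv_eq_iteratedFDeriv, iteratedFDeriv_fun_sum_apply h, sum_apply]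
  refine Finset.sum_congr rfl fun i _ => ?_
  rw [iteratedDeriv_eq_iteratedFDeriv]

/-- Time lines of a field jointly smooth on all of `ℝ × ℝ³` are smooth. [folklore] -/
theorem contDiff_timeLine_of_isSmoothSpaceTimeOn_univ {G : Type*} [NormedAddCommGroup G] [NormedSpace ℝ G]
    {W : ℝ → EuclideanSpace ℝ (Fin 3) → G} (hW : IsSmoothSpaceTimeOn univ W) (y : EuclideanSpace ℝ (Fin 3)) :
    ContDiff ℝ ∞ fun s => W s y := by
  have h1 : ContDiff ℝ ∞ (uncurry W) := by
    have h := hW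
    unfold IsSmoothSpaceTimeOn at h
    rwa [univ_prod_univ, contDiffOn_univ] at h
  exact h1.comp (contDiff_id.prodMk contDiff_const)

/-- **The Taylor polynomials of the Newtonian kernel are harmonic**: for `x ≠ 0`,
`Δ_y [DᵐΓ(x)(y,…,y)] = 0` (`DᵐΓ(x)(y,…,y) = (d/ds)ᵐ Γ∞(x + s y)|₀` for the far kernel `Γ∞ = Γ∞^{c,2c}`, `c = ‖x‖/8`;
exchange `D²_y` with `(d/ds)ᵐ`; `Δ_y Γ∞(x + s y) = s² ΔΓ∞(x + s y) = 0` for `|s| ‖y‖ < ‖x‖/2`). [folklore] -/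
theorem laplacian_newtonTaylorPoly {x : EuclideanSpace ℝ (Fin 3)} (hx : x ≠ 0) (m : ℕ) (y : EuclideanSpace ℝ (Fin 3)) :
    Δ (fun z : EuclideanSpace ℝ (Fin 3) => iteratedFDeriv ℝ m newtonKernel x (fun _ => z)) y = 0 := by
  have hx0 : 0 < ‖x‖ := norm_pos_iff.2 hx
  set c : ℝ := ‖x‖ / 8 with hc
  have hc0 : 0 < c := by positivity
  set φ : EuclideanSpace ℝ (Fin 3) → ℝ := newtonFar (c * 1) (c * 2) with hφ_def
  have hφ : ContDiff ℝ ∞ φ := contDiff_newtonFar (by positivity) (by linarith)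
  -- the field `F(s, z) = Γ∞(x + s z)`
  set F : ℝ → EuclideanSpace ℝ (Fin 3) → ℝ := fun σ z => φ (x + σ • z) with hF_def
  have hF : IsSmoothSpaceTimeOn univ F :=
    (hφ.comp (contDiff_const.add (contDiff_fst.smul contDiff_snd))).contDiffOn
  have e0 : (fun z : EuclideanSpace ℝ (Fin 3) => iteratedFDeriv ℝ m newtonKernel x (fun _ => z)) =
      fun z => iteratedDeriv m (fun σ => F σ z) 0 := by
    funext z
    rw [hF_def, iteratedDeriv_comp_line hφ x z m 0, zero_smul, add_zero,
      iteratedFDeriv_newtonFar_scale_eq hc0 (by rw [hc]; linarith) m]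
  rw [e0]
  set b := stdOrthonormalBasis ℝ (EuclideanSpace ℝ (Fin 3)) with hb
  rw [laplacian_eq_iteratedFDeriv_orthonormalBasis _ b]
  change ∑ i, iteratedFDeriv ℝ 2 (fun z => iteratedDeriv m (fun σ => F σ z) 0) y ![b i, b i] = 0
  have hex : ∀ i, iteratedFDeriv ℝ 2 (fun z => iteratedDeriv m (fun σ => F σ z) 0) y ![b i, b i] =
      iteratedDeriv m (fun σ => iteratedFDeriv ℝ 2 (F σ) y ![b i, b i]) 0 := fun i =>
    iteratedFDeriv_iteratedDeriv_apply isOpen_univ m hF 2 0 (mem_univ _) y _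
  simp only [hex]
  -- the summands are smooth in `σ`
  have hW : IsSmoothSpaceTimeOn univ (fun σ z => iteratedFDeriv ℝ 2 (F σ) z) := hF.iteratedFDeriv_slice uniqueDiffOn_univ 2
  have hgi : ∀ i, ContDiff ℝ ∞ (fun σ => iteratedFDeriv ℝ 2 (F σ) y ![b i, b i]) := fun i =>
    (ContinuousMultilinearMap.apply ℝ (fun _ : Fin 2 => EuclideanSpace ℝ (Fin 3)) ℝ ![b i, b i]).contDiff.comp
      (contDiff_timeLine_of_isSmoothSpaceTimeOn_univ hW y)
  rw [← iteratedDeriv_finset_sum _ fun i _ => ((hgi i).of_le (by exact_mod_cast le_top)).contDiffAt]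
  -- `Σᵢ D²(F σ)(y)(bᵢ,bᵢ) = Δ(F σ)(y) = σ² ΔΓ∞(x + σ y)`, which vanishes for small `σ`
  have hsum : (fun σ => ∑ i, iteratedFDeriv ℝ 2 (F σ) y ![b i, b i]) = fun σ => σ ^ 2 * Δ φ (x + σ • y) := by
    funext σ
    rw [← laplacian_comp_homothety hφ x σ y, laplacian_eq_iteratedFDeriv_orthonormalBasis _ b]
  rw [hsum]
  have hev : (fun σ : ℝ => σ ^ 2 * Δ φ (x + σ • y)) =ᶠ[𝓝 0] fun _ => (0 : ℝ) := by
    have hopen : IsOpen {σ : ℝ | ‖σ • y‖ < ‖x‖ / 2} := isOpen_lt (continuous_norm.comp (continuous_id.smul continuous_const)) continuous_const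
    have hmem : (0 : ℝ) ∈ {σ : ℝ | ‖σ • y‖ < ‖x‖ / 2} := by simp [hx0]
    filter_upwards [hopen.mem_nhds hmem] with σ hσ
    have hz : c * 2 < ‖x + σ • y‖ := by
      have h1 : ‖x‖ - ‖σ • y‖ ≤ ‖x + σ • y‖ := by
        have := norm_sub_norm_le x (-(σ • y)); rwa [norm_neg, sub_neg_eq_add] at this
      have : ‖σ • y‖ < ‖x‖ / 2 := hσ
      rw [hc]; linarith
    have hΔ : Δ φ (x + σ • y) = 0 := newtonFarLaplacian_eq_zero_of_gt (by positivity) (by linarith) hz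
    rw [hΔ, mul_zero]
  rw [iteratedDeriv_eq_of_eventuallyEq hev, iteratedDeriv_const]
  simp

/-- **The Taylor polynomials of the Newtonian kernel are solid harmonics**: for `x ≠ 0` and every `m`,
`y ↦ DᵐΓ(x)(y,…,y)` is a solid harmonic of degree `m` (smooth, homogeneous by multilinearity, harmonic by
`laplacian_newtonTaylorPoly`). [folklore] -/
theorem isSolidHarmonic_newtonTaylorPoly {x : EuclideanSpace ℝ (Fin 3)} (hx : x ≠ 0) (m : ℕ) :
    IsSolidHarmonic m fun y : EuclideanSpace ℝ (Fin 3) => iteratedFDeriv ℝ m newtonKernel x (fun _ => y) := by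
  refine ⟨?_, fun r y _ => ?_, fun y => laplacian_newtonTaylorPoly hx m y⟩
  · exact (iteratedFDeriv ℝ m newtonKernel x).contDiff.comp (contDiff_pi.2 fun _ => contDiff_id)
  · have e : (fun _ : Fin m => r • y) = fun i : Fin m => r • (fun _ : Fin m => y) i := rfl
    simp only
    rw [e, ContinuousMultilinearMap.map_smul_univ, Fin.prod_const, smul_eq_mul]

/-! ### Registered sub-goal -/

/-- **Registered helper stub `stub_paintedLadderHarmonicsTools`** of `stub_paintedLadderHigher` (crux
stmt-NavierStokesRegularity-11717, line `moment-conditioned-rellich`): derivatives of solid harmonics in fixed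
directions are solid harmonics of the lower degree (and vanish above the degree), and the Taylor polynomials
`y ↦ DᵐΓ(x)(y,…,y)` of the Newtonian kernel at `x ≠ 0` are solid harmonics of degree `m`. [folklore] -/
theorem stub_paintedLadderHarmonicsTools :
    (∀ (H : EuclideanSpace ℝ (Fin 3) → ℝ) (d : ℕ), IsSolidHarmonic d H → ∀ (b j : ℕ), d = b + j → ∀ J : Fin b → EuclideanSpace ℝ (Fin 3), IsSolidHarmonic j (fun y => iteratedFDeriv ℝ b H y J)) ∧ (∀ (H : EuclideanSpace ℝ (Fin 3) → ℝ) (d : ℕ), IsSolidHarmonic d H → ∀ (b : ℕ), d < b → ∀ (J : Fin b → EuclideanSpace ℝ (Fin 3)) (y : EuclideanSpace ℝ (Fin 3)), iteratedFDeriv ℝ b H y J = 0) ∧ (∀ (x : EuclideanSpace ℝ (Fin 3)), x ≠ 0 → ∀ m : ℕ, IsSolidHarmonic m (fun y : EuclideanSpace ℝ (Fin 3) => iteratedFDeriv ℝ m newtonKernel x (fun _ => y))) :=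
  ⟨fun _H _d hH _b _j hbj J => isSolidHarmonic_iteratedFDeriv_apply hH hbj J,
    fun _H _d hH _b hdb J y => iteratedFDeriv_apply_eq_zero_of_isSolidHarmonic hH hdb J y,
    fun _x hx m => isSolidHarmonic_newtonTaylorPoly hx m⟩

end Summit.NavierStokesRegularity.NavierStokesRegularity.Theorems.RellichScarScarRigidity

end
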